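import Summits.ResolutionOfSingularities.ResolutionOfSingularities.Theorems.TowerCutChart

/-!
# TowerCut (T4/8) — algebra of the first blow-up: the exceptional plane of a chart (general local ring part)

see `Theorems/MaxContactCutTowerCut.lean` (slice T8) for the main theorem `spreadExit_holds : SpreadExit`, the mechanism and the
sources ([Hironaka1964], [CossartJannsenSaito2020], [CutkoskyBook2004] §7).  `decomp-res-lens-2` g29, node «TowerCut».
-/

open CategoryTheory AlgebraicGeometry IsLocalRing TopologicalSpace Topology
open Literature.AlgebraicGeometry.Resolution
open Summit.ResolutionOfSingularities.ResolutionOfSingularities.Theorems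
open Summit.ResolutionOfSingularities.ResolutionOfSingularities.Theorems.WeakOrderReduction
open Summit.ResolutionOfSingularities.ResolutionOfSingularities.Theorems.DeltaFaceCutClasses
open Summit.ResolutionOfSingularities.ResolutionOfSingularities.Theorems.RelativeDeltaCut
open Summit.ResolutionOfSingularities.ResolutionOfSingularities.Theorems.SpreadCut

namespace Summit.ResolutionOfSingularities.ResolutionOfSingularities.Theorems.TowerCut

/-! ## §5  Algebra of the first blow-up: the exceptional plane of a chart and RELATIVE SIMPLICITY

For the Rees chart `B = A[e_j : j ≠ i]` of the curve centre `P = (c₀, c₁, c₂)` (`A = 𝒪_{Y,y}` regular with parameters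
`(c, v)`), the map `A[X] → B/(e₀, c_i)`, `X ↦ e_k`, is SURJECTIVE with kernel inside `P·A[X]` (from the landed
`chartQuotEquiv` presentation `B/(c_i) ≅ (A/P)[T]`); through it, `RelSimple P 𝔪 φ` at the prime `N = Ψ⁻¹(𝔴)` yields that
`φ(e_k)` is a regular parameter of `B_𝔴` transversal to `(e₀, c_i)` (primary decomposition argument at a maximal `N`,
unit argument at `N = 𝔪·A[X]`). -/

section SpreadAlg

open Polynomial in
/-- A prime of `A[X]` strictly above `𝔪·A[X]` (`A` local) is maximal: `A[X]/𝔪A[X] ≅ k[X]` is a PID. [folklore] -/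
theorem isMaximal_of_isPrime_of_map_C_ne {A : Type} [CommRing A] [IsLocalRing A] (N : Ideal A[X]) [hN : N.IsPrime]
    (hle : (maximalIdeal A).map (C : A →+* A[X]) ≤ N) (hne : (maximalIdeal A).map (C : A →+* A[X]) ≠ N) :
    N.IsMaximal := by
  letI := Ideal.Quotient.field (maximalIdeal A)
  set M : Ideal A[X] := (maximalIdeal A).map (C : A →+* A[X]) with hM
  let e : (A ⧸ maximalIdeal A)[X] ≃+* A[X] ⧸ M := Ideal.polynomialQuotientEquivQuotientPolynomial (maximalIdeal A)
  have hker : RingHom.ker (Ideal.Quotient.mk M) ≤ N := by rw [Ideal.mk_ker]; exact hle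
  haveI hNbar : (N.map (Ideal.Quotient.mk M)).IsPrime := Ideal.map_isPrime_of_surjective Ideal.Quotient.mk_surjective hker
  set p : Ideal (A ⧸ maximalIdeal A)[X] := (N.map (Ideal.Quotient.mk M)).comap (e : (A ⧸ maximalIdeal A)[X] →+* A[X] ⧸ M)
    with hp
  haveI : p.IsPrime := Ideal.IsPrime.comap _
  have hpne : p ≠ ⊥ := by
    intro h
    apply hne
    refine le_antisymm hle fun f hf => ?_
    have h1 : e.symm (Ideal.Quotient.mk M f) ∈ p := by
      rw [hp, Ideal.mem_comap]
      change e (e.symm _) ∈ _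
      rw [RingEquiv.apply_symm_apply]
      exact Ideal.mem_map_of_mem _ hf
    rw [h, Ideal.mem_bot, map_eq_zero_iff _ e.symm.injective, Ideal.Quotient.eq_zero_iff_mem] at h1
    exact h1
  haveI : p.IsMaximal := IsPrime.to_maximal_ideal hpne
  have hNbar' : N.map (Ideal.Quotient.mk M) = p.comap (e.symm : A[X] ⧸ M →+* (A ⧸ maximalIdeal A)[X]) := by
    rw [hp, Ideal.comap_comap]
    ext x
    simp only [Ideal.mem_comap, RingHom.comp_apply]
    change x ∈ _ ↔ e (e.symm x) ∈ _
    rw [RingEquiv.apply_symm_apply]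
  haveI : (N.map (Ideal.Quotient.mk M)).IsMaximal := by
    rw [hNbar']
    exact Ideal.comap_isMaximal_of_surjective _ e.symm.surjective
  have hN' : N = (N.map (Ideal.Quotient.mk M)).comap (Ideal.Quotient.mk M) := by
    rw [Ideal.comap_map_of_surjective _ Ideal.Quotient.mk_surjective, ← RingHom.ker_eq_comap_bot]
    exact (sup_eq_left.mpr hker).symm
  rw [hN']
  exact Ideal.comap_isMaximal_of_surjective _ Ideal.Quotient.mk_surjective

/-- Localisation membership: `x/1 ∈ I·S` gives `m x ∈ I` for some `m` in the submonoid. [folklore] -/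
theorem exists_mul_mem_of_algebraMap_mem_map {R S : Type} [CommRing R] [CommRing S] [Algebra R S] (M : Submonoid R)
    [IsLocalization M S] {I : Ideal R} {x : R} (h : algebraMap R S x ∈ I.map (algebraMap R S)) :
    ∃ m ∈ M, m * x ∈ I := by
  obtain ⟨⟨a, s⟩, has⟩ := (IsLocalization.mem_map_algebraMap_iff M S).mp h
  have has' : algebraMap R S (x * s) = algebraMap R S a := by rw [map_mul]; exact has
  obtain ⟨c, hc⟩ := (IsLocalization.eq_iff_exists M S).mp has'
  refine ⟨c * s, M.mul_mem c.2 s.2, ?_⟩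
  have : (c : R) * (s : R) * x = c * a := by rw [← hc]; ring
  rw [this]
  exact I.mul_mem_left _ a.2

/-- **Extending `(a, b)` by a transversal parameter**: if `(a, b)` is part of a regular system of parameters and
`x ∈ 𝔪 ∖ (𝔪² + (a, b))`, then so is `(a, b, x)` (`S/(a,b)` regular, `x̄ ∈ 𝔪̄ ∖ 𝔪̄²`).
[cite: Matsumura1987, Thm. 14.2] -/
theorem isRsopPart_triple_of_not_mem {S : Type} [CommRing S] [IsLocalRing S] {a b x : S}
    (hab : IsRsopPart ![a, b]) (hx : x ∈ maximalIdeal S)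
    (hx2 : x ∉ maximalIdeal S ^ 2 ⊔ Ideal.span (Set.range ![a, b])) : IsRsopPart ![a, b, x] := by
  haveI := hab.isRegularLocalRing
  have hIm : Ideal.span (Set.range ![a, b]) ≤ maximalIdeal S := hab.span_range_le_maximalIdeal
  have hIne : Ideal.span (Set.range ![a, b]) ≠ ⊤ := fun h =>
    (maximalIdeal.isMaximal S).ne_top (top_le_iff.mp (h ▸ hIm))
  haveI : Nontrivial (S ⧸ Ideal.span (Set.range ![a, b])) := Ideal.Quotient.nontrivial_iff.mpr hIne
  haveI : IsLocalRing (S ⧸ Ideal.span (Set.range ![a, b])) :=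
    IsLocalRing.of_surjective' (Ideal.Quotient.mk _) Ideal.Quotient.mk_surjective
  haveI hq : IsRegularLocalRing (S ⧸ Ideal.span (Set.range ![a, b])) := hab.isRegularLocalRing_quotient
  have hmQ : maximalIdeal (S ⧸ Ideal.span (Set.range ![a, b])) =
      (maximalIdeal S).map (Ideal.Quotient.mk (Ideal.span (Set.range ![a, b]))) :=
    maximalIdeal_quotient_eq_map _
  have h1 : Ideal.Quotient.mk (Ideal.span (Set.range ![a, b])) x ∈ maximalIdeal (S ⧸ Ideal.span (Set.range ![a, b])) := by
    rw [hmQ]; exact Ideal.mem_map_of_mem _ hx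
  have h2 : Ideal.Quotient.mk (Ideal.span (Set.range ![a, b])) x ∉
      maximalIdeal (S ⧸ Ideal.span (Set.range ![a, b])) ^ 2 := by
    intro h
    rw [hmQ, ← Ideal.map_pow, ← Ideal.mem_comap, Ideal.comap_map_of_surjective _ Ideal.Quotient.mk_surjective,
      ← RingHom.ker_eq_comap_bot, Ideal.mk_ker] at h
    exact hx2 h
  obtain ⟨hreg, hdim⟩ := IsRegularLocalRing.quotient_span_singleton h1 h2
  have hJ : Ideal.span (Set.range ![a, b, x]) = Ideal.span (Set.range ![a, b]) ⊔ Ideal.span {x} := by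
    rw [← Ideal.span_union]
    congr 1
    ext y
    simp only [Matrix.range_cons, Matrix.range_empty, Set.union_empty, Set.union_singleton, Set.mem_insert_iff,
      Set.mem_singleton_iff, Set.mem_union]
    tauto
  have hmapx : (Ideal.span {x}).map (Ideal.Quotient.mk (Ideal.span (Set.range ![a, b]))) =
      Ideal.span {Ideal.Quotient.mk (Ideal.span (Set.range ![a, b])) x} := by
    rw [Ideal.map_span, Set.image_singleton]
  let e : (S ⧸ Ideal.span (Set.range ![a, b])) ⧸ Ideal.span {Ideal.Quotient.mk (Ideal.span (Set.range ![a, b])) x} ≃+*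
      S ⧸ Ideal.span (Set.range ![a, b, x]) :=
    (Ideal.quotEquivOfEq hmapx.symm).trans
      ((DoubleQuot.quotQuotEquivQuotSup (Ideal.span (Set.range ![a, b])) (Ideal.span {x})).trans
        (Ideal.quotEquivOfEq hJ.symm))
  haveI : IsRegularLocalRing (S ⧸ Ideal.span (Set.range ![a, b, x])) := IsRegularLocalRing.of_ringEquiv e
  refine IsRsopPart.of_isRegularLocalRing_quotient (fun j => ?_) ?_
  · fin_cases j
    · exact hab.mem_maximalIdeal 0
    · exact hab.mem_maximalIdeal 1
    · exact hx
  · rw [← ringKrullDim_eq_of_ringEquiv e, ← hab.ringKrullDim_quotient_add, ← hdim]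
    have h3 : ((3 : ℕ) : WithBot ℕ∞) = 1 + ((2 : ℕ) : WithBot ℕ∞) := by
      rw [← Nat.cast_one, ← Nat.cast_add]
    rw [h3, ← add_assoc]

/-- Being part of a regular system of parameters depends only on the ideal spanned (same length). [folklore] -/
theorem isRsopPart_of_span_range_eq {R : Type} [CommRing R] [IsLocalRing R] {n : ℕ} {z z' : Fin n → R}
    (hz : IsRsopPart z) (h : Ideal.span (Set.range z) = Ideal.span (Set.range z')) : IsRsopPart z' := by
  obtain ⟨hR, e, y, hdim, hspan⟩ := hz
  refine ⟨hR, e, y, hdim, ?_⟩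
  rw [Ideal.span_union] at hspan ⊢
  rw [← h]
  exact hspan

variable {A : Type} [CommRing A]

open Polynomial in
/-- **`A[X] → B/(e₀, c_i)`, `X ↦ e_k`, is surjective** (`B = A[e₀, e_k]`). [folklore] -/
theorem mk_comp_eval₂_surjective (c : Fin 3 → A) (i k : Fin 3) (h0i : (0 : Fin 3) ≠ i) (hki : k ≠ i) (hk0 : k ≠ 0) :
    Function.Surjective ((Ideal.Quotient.mk (Ideal.span {chartGen c i 0, chartBase c i (c i)})).comp
      (eval₂RingHom (chartBase c i) (chartGen c i k))) := by
  classical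
  intro b
  obtain ⟨b, rfl⟩ := Ideal.Quotient.mk_surjective b
  obtain ⟨p, rfl⟩ := eval₂Hom_chartGen_surjective c i b
  let κ : MvPolynomial {j : Fin 3 // j ≠ i} A →+* A[X] :=
    MvPolynomial.eval₂Hom (C : A →+* A[X]) fun j : {j : Fin 3 // j ≠ i} => if j.1 = k then (X : A[X]) else 0
  refine ⟨κ p, ?_⟩
  change (((Ideal.Quotient.mk _).comp (eval₂RingHom (chartBase c i) (chartGen c i k))).comp κ) p =
    ((Ideal.Quotient.mk _).comp (MvPolynomial.eval₂Hom (chartBase c i)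
      fun j : {j : Fin 3 // j ≠ i} => chartGen c i j.1)) p
  congr 1
  refine MvPolynomial.ringHom_ext (fun r => ?_) (fun j => ?_)
  · simp only [RingHom.comp_apply, κ, MvPolynomial.eval₂Hom_C, coe_eval₂RingHom, eval₂_C]
  · by_cases hj : j.1 = k
    · simp only [RingHom.comp_apply, κ, MvPolynomial.eval₂Hom_X', hj, if_true, coe_eval₂RingHom, eval₂_X]
    · have hj0 : j.1 = 0 := by
        apply Fin.ext
        have h1 := Fin.val_ne_of_ne j.2
        have h2 := Fin.val_ne_of_ne hj
        have h3 := Fin.val_ne_of_ne h0i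
        have h4 := Fin.val_ne_of_ne hki
        have h5 := Fin.val_ne_of_ne hk0
        have := j.1.isLt; have := i.isLt; have := k.isLt
        simp only [Fin.val_zero] at *
        omega
      have hκ : κ (MvPolynomial.X j) = 0 := by
        simp only [κ, MvPolynomial.eval₂Hom_X', if_neg hj]
      rw [RingHom.comp_apply, hκ, map_zero, RingHom.comp_apply, MvPolynomial.eval₂Hom_X', eq_comm,
        Ideal.Quotient.eq_zero_iff_mem, hj0]
      exact Ideal.subset_span (Set.mem_insert _ _)

open Polynomial in
/-- **The kernel of `A[X] → B/(e₀, c_i)` lies in `P·A[X]`** (`P = (c)` quasi-regular; from the landed presentation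
`ker (A[T] → B/(c_i)) = P·A[T]`). [cite: StacksProject, Tag 0BIQ] -/
theorem ker_mk_comp_eval₂_le (c : Fin 3 → A) (hc : IsQuasiRegular c) (i k : Fin 3) (h0i : (0 : Fin 3) ≠ i)
    (hki : k ≠ i) (hk0 : k ≠ 0) :
    RingHom.ker ((Ideal.Quotient.mk (Ideal.span {chartGen c i 0, chartBase c i (c i)})).comp
      (eval₂RingHom (chartBase c i) (chartGen c i k))) ≤ (Ideal.span (Set.range c)).map (C : A →+* A[X]) := by
  classical
  intro f hf
  rw [RingHom.mem_ker, RingHom.comp_apply, Ideal.Quotient.eq_zero_iff_mem, Ideal.mem_span_pair] at hf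
  obtain ⟨b₁, b₂, hb⟩ := hf
  obtain ⟨r₁, hr₁⟩ := eval₂Hom_chartGen_surjective c i b₁
  let ι : A[X] →+* MvPolynomial {j : Fin 3 // j ≠ i} A := eval₂RingHom MvPolynomial.C (MvPolynomial.X ⟨k, hki⟩)
  let κ : MvPolynomial {j : Fin 3 // j ≠ i} A →+* A[X] :=
    MvPolynomial.eval₂Hom (C : A →+* A[X]) fun j : {j : Fin 3 // j ≠ i} => if j.1 = k then (X : A[X]) else 0
  let ev : MvPolynomial {j : Fin 3 // j ≠ i} A →+* chartRing c i :=
    MvPolynomial.eval₂Hom (chartBase c i) fun j : {j : Fin 3 // j ≠ i} => chartGen c i j.1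
  have hκι : κ.comp ι = RingHom.id _ := by
    refine Polynomial.ringHom_ext (fun a => ?_) ?_
    · simp only [RingHom.comp_apply, ι, κ, coe_eval₂RingHom, eval₂_C, MvPolynomial.eval₂Hom_C, RingHom.id_apply]
    · simp only [RingHom.comp_apply, ι, κ, coe_eval₂RingHom, eval₂_X, MvPolynomial.eval₂Hom_X', if_true,
        RingHom.id_apply]
  have hevι : ev.comp ι = eval₂RingHom (chartBase c i) (chartGen c i k) := by
    refine Polynomial.ringHom_ext (fun a => ?_) ?_
    · simp only [RingHom.comp_apply, ι, ev, coe_eval₂RingHom, eval₂_C, MvPolynomial.eval₂Hom_C]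
    · simp only [RingHom.comp_apply, ι, ev, coe_eval₂RingHom, eval₂_X, MvPolynomial.eval₂Hom_X']
  have hF : ι f - MvPolynomial.X ⟨0, h0i⟩ * r₁ ∈
      RingHom.ker ((Ideal.Quotient.mk (Ideal.span {chartBase c i (c i)})).comp ev) := by
    rw [RingHom.mem_ker, RingHom.comp_apply, Ideal.Quotient.eq_zero_iff_mem, map_sub, map_mul,
      ← RingHom.comp_apply ev ι, hevι, hr₁]
    simp only [ev, MvPolynomial.eval₂Hom_X']
    refine Ideal.mem_span_singleton'.mpr ⟨b₂, ?_⟩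
    rw [← hb]
    ring
  rw [ker_quotient_comp_eval₂Hom_eq c i hc] at hF
  have hκF := Ideal.mem_map_of_mem κ hF
  rw [map_sub, map_mul, ← RingHom.comp_apply κ ι, hκι, RingHom.id_apply] at hκF
  have hX0 : κ (MvPolynomial.X ⟨0, h0i⟩) = 0 := by
    simp only [κ, MvPolynomial.eval₂Hom_X']
    rw [if_neg (Ne.symm hk0)]
  rw [hX0, zero_mul, sub_zero, Ideal.map_map] at hκF
  have hκC : κ.comp MvPolynomial.C = C := RingHom.ext fun a => by
    simp only [RingHom.comp_apply, κ, MvPolynomial.eval₂Hom_C]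
  rwa [hκC] at hκF


end SpreadAlg

end Summit.ResolutionOfSingularities.ResolutionOfSingularities.Theorems.TowerCut
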